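import Literature.Computability.QuantumComplexity.GRKitPlugFP
import Literature.Computability.QuantumComplexity.QFTStageAbstract
import Literature.Computability.QuantumComplexity.GenKitWords
import Literature.Computability.QuantumComplexity.UniversalExecutor
import HarnessLib

/-!
# The abstract word of the Fourier block, indexed by naturals, and on codes (stage S4 of the sampler's uniformity)

Topic `Literature/Computability/QuantumComplexity`; stage S4 of the UNIFORMITY of Regev's sampler ([Regev2009, Lemma 3.14, proof];
Arora–Barak §6.2; the QFT layout of Nielsen–Chuang §5.1). `QFTStageAbstract.lean` computes the abstract gate list of the Fourier
block as `(List.finRange κ).flatMap QFTWord.roundA` with `roundA j = [H (ws j)] ++ (List.finRange κ).reverse.flatMap (pairA j ·)` and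
`pairA j l = if j < l then oaaWordA (phaseSandwichA had (phaseOps…) [cr] [phaseFlag…]) (reflectA …) else []`, over the kit
`QFTKit.kit κ k` and the data wires `QFTKit.dataEmb κ k` (`dataEmb_val : value j`). This file

* rewrites these words as functions of NATURAL indices and of the kit RECORD `QFTKit.gpOf κ k` only — `QFTWord.pairAN κ k j l`,
  `roundAN κ k j`, `blockAN κ k` — and proves the bridge `pairA_eq_pairAN`, `roundA_eq_roundAN`, **`QFTStage.map_toAG_block_eq_blockAN`**
  (`(QFTStage.block hk1).gates.map toAG = blockAN κ k`), using `QFTKit.map_val_phaseOps_dataEmb`, `val_phaseFlag`, `kit_*_val`;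
* puts them on codes: `pairAN_codeFP_of`, `roundAN_codeFP_of`, **`blockAN_codeFP_of (hκ : CodeFP eσ unE κ) (hk : CodeFP eσ unE k) :
  CodeFP eσ (rawE agE0) (fun c => blockAN (κ c) (k c))`** — the whole Fourier block word is a polynomial-time function of `(κ, k)` in unary —
  from `QFTKit.phaseOpsA_codeFP_of` / `phaseFlagA_codeFP_of` / the kit lists (`GRKitPlugFP.lean`), `AJLCore.oaaWordA_fp`,
  `phaseSandwichA_fp` (`CoreDescBlockFP.lean`) and `UExec.flatMapRange` (twice), with the folklore `List.flatMap_reverse_range`.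

Everything is proved; no named fact is introduced.

## References

* O. Regev, J. ACM 56(6) (2009), Lemma 3.14 (proof) [Regev2009].
* S. Arora, B. Barak, *Computational Complexity: A Modern Approach*, CUP 2009, §6.2 [AroraBarak2009].
* M. A. Nielsen, I. L. Chuang, *Quantum Computation and Quantum Information*, CUP 2010, §5.1 [NielsenChuang2010].
-/

noncomputable section

namespace Literature.Computability.QuantumComplexity

open _root_.Computability Cryptography Complexity Complexity.CodeFP SLP RevDesc AJLCore

/-- Reversed ranges as ranges (folklore list identity). [folklore] -/
private theorem List.flatMap_reverse_range {β : Type} (f : ℕ → List β) (κ : ℕ) :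
    (List.range κ).reverse.flatMap f = (List.range κ).flatMap (fun i => f (κ - 1 - i)) := by
  rw [List.range_eq_range', List.reverse_range', List.flatMap_map, ← List.range_eq_range']
  exact List.flatMap_congr fun i _ => by rw [Nat.zero_add]

namespace QFTWord

/-- The denominator exponent of the pair `(j, l)`, `l − j + 1`, capped (equal to `QFTWord.mOf j l` for `l < κ`). [folklore] [cite: AroraBarak2009, §6.2 (proof of Thm. 6.15)] -/
def mStd (κ j l : ℕ) : ℕ := min (l - j) κ + 1

/-- The compiled phase program of the pair. [folklore] [cite: AroraBarak2009, §6.2 (proof of Thm. 6.15)] -/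
def progN (κ k j l : ℕ) : List SLP.Instr × ℕ × ℕ × ℕ := (qftPhaseB k (cosThr (mStd κ j l) k) (sinThr (mStd κ j l) k)).compile (thrWd k) 0 0

/-- **The abstract pair word over natural indices and the kit record.** [cite: NielsenChuang2010, §5.1] -/
def pairAN (κ k j l : ℕ) : List AG :=
  if j < l then
    oaaWordA (phaseSandwichA ((QFTKit.gpOf κ k).cr :: (QFTKit.gpOf κ k).as)
        ((QFTKit.gpOf κ k).gopsA [(QFTKit.gpOf κ k).d0, j, l] (progN κ k j l)) [(QFTKit.gpOf κ k).cr]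
        [(QFTKit.gpOf κ k).gflagA (progN κ k j l)]) (QFTKit.gpOf κ k).GRA
  else []

/-- **The abstract round word over natural indices.** [cite: NielsenChuang2010, §5.1] -/
def roundAN (κ k j : ℕ) : List AG := [⟨.H, [j]⟩] ++ (List.range κ).reverse.flatMap (pairAN κ k j)

/-- **The abstract Fourier block word over natural indices.** [cite: NielsenChuang2010, §5.1] -/
def blockAN (κ k : ℕ) : List AG := (List.range κ).flatMap (roundAN κ k)

variable (κ k : ℕ)

/-- The compiled program of the pair is the one of `QFTWord.prog`. [folklore] [cite: AroraBarak2009, §6.2 (proof of Thm. 6.15)] -/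
theorem progN_eq (j l : Fin κ) : progN κ k j l = (prog k j l).compile (thrWd k) 0 0 := by
  unfold progN mStd prog mOf
  rw [Nat.min_eq_left (by omega)]

/-- **Bridge for the pair word.** [folklore] [cite: AroraBarak2009, §6.2 (proof of Thm. 6.15)] -/
theorem pairA_eq_pairAN (j l : Fin κ) : pairA (kit := QFTKit.kit κ k) (ws := QFTKit.dataEmb κ k) j l = pairAN κ k j l := by
  unfold pairA pairAN
  by_cases h : j < l
  · rw [if_pos h, if_pos (Fin.lt_def.1 h), QFTKit.map_val_phaseOps_dataEmb, QFTKit.val_phaseFlag, List.map_cons, List.map_append,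
      QFTKit.kit_as_val, QFTKit.kit_region_val, QFTKit.kit_hs_val, progN_eq]
    rfl
  · rw [if_neg h, if_neg (fun h' => h (Fin.lt_def.2 h'))]

/-- **Bridge for the round word.** [folklore] [cite: AroraBarak2009, §6.2 (proof of Thm. 6.15)] -/
theorem roundA_eq_roundAN (j : Fin κ) : roundA (kit := QFTKit.kit κ k) (ws := QFTKit.dataEmb κ k) j = roundAN κ k j := by
  unfold roundA roundAN
  rw [QFTKit.dataEmb_val, ← List.map_coe_finRange_eq_range, ← List.map_reverse, List.flatMap_map]
  exact congrArg _ (List.flatMap_congr fun l _ => pairA_eq_pairAN κ k j l)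

end QFTWord

namespace QFTStage

/-- **The abstract gate list of the Fourier block is `blockAN κ k`.** [cite: Regev2009, Lemma 3.14 (proof)] [cite: NielsenChuang2010, §5.1] -/
theorem map_toAG_block_eq_blockAN {k κ : ℕ} (hk1 : 1 ≤ k) : (block (κ := κ) hk1).gates.map toAG = QFTWord.blockAN κ k := by
  rw [map_toAG_block, QFTWord.blockAN, ← List.map_coe_finRange_eq_range, List.flatMap_map]
  exact List.flatMap_congr fun j _ => QFTWord.roundA_eq_roundAN κ k j

end QFTStage

namespace QFTWord

variable {σ : Type} {eσ : σ → List Bool} {κ k : σ → ℕ} (hκ : CodeFP eσ unE κ) (hk : CodeFP eσ unE k)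
include hκ hk

/-- **The pair word on codes** (context `(c, j)`, index `l`). [cite: Regev2009, Lemma 3.14 (proof)] [cite: AroraBarak2009, §6.2 (proof of Thm. 6.15)] -/
theorem pairAN_codeFP_of : CodeFP (pairE (pairE eσ natE) natE) (rawE agE0) (fun q => pairAN (κ q.1.1) (k q.1.1) q.1.2 q.2) := by
  have C : CodeFP (pairE (pairE eσ natE) natE) eσ (fun q => q.1.1) := (fst _ _).comp (fst _ _)
  have J : CodeFP (pairE (pairE eσ natE) natE) natE (fun q => q.1.2) := (snd _ _).comp (fst _ _)
  have L : CodeFP (pairE (pairE eσ natE) natE) natE (fun q => q.2) := snd _ _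
  have M : CodeFP (pairE (pairE eσ natE) natE) unE (fun q => mStd (κ q.1.1) q.1.2 q.2) :=
    (unSucc.comp (unOfNatMin.comp ((hκ.comp C).pair (natSub.comp (L.pair J)))) :)
  have OPS : CodeFP (pairE (pairE eσ natE) natE) (rawE clopE)
      (fun q => (QFTKit.gpOf (κ q.1.1) (k q.1.1)).gopsA [(QFTKit.gpOf (κ q.1.1) (k q.1.1)).d0, q.1.2, q.2] (progN (κ q.1.1) (k q.1.1) q.1.2 q.2)) :=
    (QFTKit.phaseOpsA_codeFP_of (j := fun p l => p.2) (l := fun _ l => l) (m := fun p l => mStd (κ p.1) p.2 l)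
      (hκ.comp (fst _ _)) (hk.comp (fst _ _)) J L M :)
  have FLAG : CodeFP (pairE (pairE eσ natE) natE) natE (fun q => (QFTKit.gpOf (κ q.1.1) (k q.1.1)).gflagA (progN (κ q.1.1) (k q.1.1) q.1.2 q.2)) :=
    (QFTKit.phaseFlagA_codeFP_of (m := fun p l => mStd (κ p.1) p.2 l) (hκ.comp (fst _ _)) (hk.comp (fst _ _)) M :)
  have HAD := (QFTKit.hadA_codeFP_of hκ hk).comp C
  have CR := (QFTKit.crA_codeFP_of hκ hk).comp C
  have GRA := (QFTKit.GRA_codeFP_of hκ hk).comp C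
  have W : CodeFP (pairE (pairE eσ natE) natE) (rawE agE0) (fun q =>
      oaaWordA (phaseSandwichA ((QFTKit.gpOf (κ q.1.1) (k q.1.1)).cr :: (QFTKit.gpOf (κ q.1.1) (k q.1.1)).as)
        ((QFTKit.gpOf (κ q.1.1) (k q.1.1)).gopsA [(QFTKit.gpOf (κ q.1.1) (k q.1.1)).d0, q.1.2, q.2] (progN (κ q.1.1) (k q.1.1) q.1.2 q.2))
        [(QFTKit.gpOf (κ q.1.1) (k q.1.1)).cr] [(QFTKit.gpOf (κ q.1.1) (k q.1.1)).gflagA (progN (κ q.1.1) (k q.1.1) q.1.2 q.2)])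
        (QFTKit.gpOf (κ q.1.1) (k q.1.1)).GRA) :=
    (oaaWordA_fp.comp ((phaseSandwichA_fp.comp (HAD.pair (OPS.pair (((rawSingleton natE).comp CR).pair ((rawSingleton natE).comp FLAG))))).pair GRA) :)
  exact (ite (natLt.comp (J.pair L)) W (const _ ([] : List AG))).congr fun q => by
    unfold pairAN
    by_cases h : q.1.2 < q.2
    · rw [if_pos h, decide_eq_true h, if_pos rfl]
    · rw [if_neg h, decide_eq_false h, if_neg Bool.false_ne_true]

/-- **The round word on codes** (context `c`, index `j`). [cite: Regev2009, Lemma 3.14 (proof)] [cite: AroraBarak2009, §6.2 (proof of Thm. 6.15)] -/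
theorem roundAN_codeFP_of : CodeFP (pairE eσ natE) (rawE agE0) (fun p => roundAN (κ p.1) (k p.1) p.2) := by
  have hF : CodeFP (pairE (pairE eσ natE) natE) (rawE agE0) (fun q => pairAN (κ q.1.1) (k q.1.1) q.1.2 (κ q.1.1 - 1 - q.2)) :=
    ((pairAN_codeFP_of hκ hk).comp ((fst _ _).pair (natSub.comp ((natSub.comp ((BP.toNat (hκ.comp ((fst _ _).comp (fst _ _)))).pair
      (const _ 1))).pair (snd _ _)))) :)
  exact (agAppend (agList1 (ag_H (snd _ _))) (UExec.flatMapRange (k := fun p : σ × ℕ => κ p.1)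
    (F := fun p i => pairAN (κ p.1) (k p.1) p.2 (κ p.1 - 1 - i)) (hκ.comp (fst _ _)) hF)).congr fun p => by
    unfold roundAN
    rw [List.flatMap_reverse_range]

/-- **The Fourier block word on codes.** [cite: Regev2009, Lemma 3.14 (proof)] [cite: AroraBarak2009, §6.2 (proof of Thm. 6.15)] -/
theorem blockAN_codeFP_of : CodeFP eσ (rawE agE0) (fun c => blockAN (κ c) (k c)) :=
  (UExec.flatMapRange (k := κ) (F := fun c j => roundAN (κ c) (k c) j) hκ (roundAN_codeFP_of hκ hk) :)

end QFTWord

end Literature.Computability.QuantumComplexity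

end
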